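import Literature.Geometry.Manifold.DeRhamFundamentalClassPairing
import Literature.Geometry.Symplectic.SymplecticOrientation
import Literature.Geometry.Riemannian.EulerFormFour
import Literature.NumberTheory.Transcendental.FormsAlgebraWedgeAssocProofs
import Literature.NumberTheory.Transcendental.FormsAlgebraWedgeCommProofs
import HarnessLib

/-!
# `ω ∧ ω = 2 Pf(ω) e⁰¹²³` on `ℝ⁴`; the square of a symplectic form is a volume form, and its
# de Rham class pairs non-trivially with the fundamental class

McDuff–Salamon (2017), §2.1 Cor. 2.1.4 ("`ω` is nondegenerate if and only if `ωⁿ ≠ 0`") and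
§4.1 / proof of Thm. 13.3.11 (`ω ∧ ω` orients a symplectic `4`-manifold and `[ω] ∪ [ω] ≠ 0`):

* `wedge_apply_two_two` — the `(2, 2)` case of the shuffle formula for the tree's wedge product
  (`ContinuousAlternatingMap.wedge`, Warner (1983), 2.10(b)): for `2`-forms `a`, `b` on a real
  normed space and vectors `v₀, …, v₃`,
  `(a ∧ b)(v) = a(v₀,v₁)b(v₂,v₃) − a(v₀,v₂)b(v₁,v₃) + a(v₀,v₃)b(v₁,v₂) + a(v₁,v₂)b(v₀,v₃)
   − a(v₁,v₃)b(v₀,v₂) + a(v₂,v₃)b(v₀,v₁)`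
  (the `24`-term signed sum over `S₄`, `Literature.Geometry.Riemannian.sum_perm_sign_mul_eq_altSumFour`,
  divided by `2! 2!`);
* `wedge_self_apply_two_two` — `(a ∧ a)(v) = 2 (a₀₁a₂₃ − a₀₂a₁₃ + a₀₃a₁₂)`, and on `ℝ⁴`,
  `wedge_self_apply_stdVec : (α ∧ α)(e₀, e₁, e₂, e₃) = 2 Pf(α)` (the tree's `pfaffian`,
  `OrigamiForm.lean`), so **`α ∧ α ≠ 0` for a nondegenerate `α`**
  (`wedge_self_ne_zero_of_nondegenerate`, via `pfaffian_ne_zero_of_nondegenerate`);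
* `wedge_self_castDeg_mem_closedSmoothForms`, `wedge_self_castDeg_apply_ne_zero` — for a smooth
  closed pointwise-nondegenerate `2`-form `s` on a `4`-manifold, `s ∧ s` (cast to degree `4`) is a
  smooth closed nowhere-vanishing top form (wedge calculus of `FormsAlgebra`, unconditional by
  `wedgeFacts_of_comm (WedgeComm_holds …)`);
* `kroneckerPairing_integrationDeRham_wedge_self_ne_zero` — hence **`⟨e_N [s ∧ s], [N] ⊗ 1⟩ ≠ 0`**
  for every homological `ℤ`-orientation of the closed connected `N`
  (`Literature.Geometry.Manifold.kroneckerPairing_integrationDeRham_fundamentalClass_ne_zero`), and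
  `cup_self_deRham_eq` : `[s] ⌣ [s] = [s ∧ s]` in `H⁴_dR(N)`;
* `kroneckerPairing_cupProduct_integrationDeRham_ne_zero_of_isMultiplicative` — **granted
  multiplicativity of the integration isomorphisms** (`(integrationDeRhamIsoFamily ℝ⁴).IsMultiplicative`,
  the exact residual content of the named fact `exists_deRhamIsoFamily`, see
  `exists_deRhamIsoFamily_of_isMultiplicative`; kept as an explicit hypothesis, D-0026), the real
  class `y = e_N [s] ∈ H²(N; ℝ)` has `⟨y ∪ y, [N] ⊗ 1⟩ ≠ 0` — the input "`[ω]² ≠ 0`" of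
  `b⁺ ≥ 1` (McDuff–Salamon, proof of Thm. 13.3.11), conjunct (i) of
  `canonicalClass_sq_and_adjunction_of_symplectic_four`.

Everything is proved; no definitions, no named facts.

## References

* D. McDuff, D. Salamon, *Introduction to Symplectic Topology*, 3rd ed., OUP (2017), §2.1
  Cor. 2.1.4; Def. 4.1.4; proof of Thm. 13.3.11. [McDuffSalamon2017]
* F. W. Warner, *Foundations of Differentiable Manifolds and Lie Groups*, GTM 94 (1983), 2.10(b).
  [WarnerGTM94]
-/

noncomputable section

open scoped Manifold ContDiff Topology
open Set Function Module
open Literature.AlgebraicTopology.SingularHomology Literature.Geometry.Kaehler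
  Literature.Geometry.Manifold Literature.NumberTheory.Transcendental

namespace Literature.Geometry.Symplectic

/-! ### The `(2,2)` shuffle formula -/

section Algebra

variable {V : Type*} [NormedAddCommGroup V] [NormedSpace ℝ V]

/-- A `2`-form is antisymmetric: `a(y, x) = -a(x, y)`. [folklore] -/
theorem alt_two_swap_args (a : V [⋀^Fin 2]→L[ℝ] ℝ) (x y : V) : a ![y, x] = -a ![x, y] := by
  have h := a.map_swap ![x, y] (i := 0) (j := 1) (by decide)
  have hsw : (![x, y] : Fin 2 → V) ∘ Equiv.swap (0 : Fin 2) 1 = ![y, x] := by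
    funext k
    fin_cases k <;> rfl
  rw [hsw] at h
  exact h

/-- **The `(2, 2)` shuffle formula** for the wedge product of two `2`-forms (Warner (1983),
2.10(b): `(a ∧ b)(v) = (2! 2!)⁻¹ ∑_{σ ∈ S₄} sign σ · a(v_{σ0}, v_{σ1}) b(v_{σ2}, v_{σ3})`, i.e. the
sum over the six `(2,2)`-shuffles). [cite: WarnerGTM94, 2.10(b)] -/
theorem wedge_apply_two_two (a b : V [⋀^Fin 2]→L[ℝ] ℝ) (v : Fin 4 → V) :
    a.wedge b v =
      a ![v 0, v 1] * b ![v 2, v 3] - a ![v 0, v 2] * b ![v 1, v 3] + a ![v 0, v 3] * b ![v 1, v 2]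
        + a ![v 1, v 2] * b ![v 0, v 3] - a ![v 1, v 3] * b ![v 0, v 2]
        + a ![v 2, v 3] * b ![v 0, v 1] := by
  rw [ContinuousAlternatingMap.wedge_apply]
  have h1 : ∀ σ : Equiv.Perm (Fin 4), (fun i : Fin 2 ↦ v (σ (Fin.castAdd 2 i))) = ![v (σ 0), v (σ 1)] := by
    intro σ
    funext i
    fin_cases i <;> rfl
  have h2 : ∀ σ : Equiv.Perm (Fin 4), (fun j : Fin 2 ↦ v (σ (Fin.natAdd 2 j))) = ![v (σ 2), v (σ 3)] := by
    intro σ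
    funext j
    fin_cases j <;> rfl
  have hsum : ∑ σ : Equiv.Perm (Fin 4), Equiv.Perm.sign σ •
      (a (fun i : Fin 2 ↦ v (σ (Fin.castAdd 2 i))) * b (fun j : Fin 2 ↦ v (σ (Fin.natAdd 2 j)))) =
      Literature.Geometry.Riemannian.altSumFour (fun i j k l ↦ a ![v i, v j] * b ![v k, v l]) := by
    rw [← Literature.Geometry.Riemannian.sum_perm_sign_mul_eq_altSumFour]
    refine Finset.sum_congr rfl fun σ _ ↦ ?_
    rw [h1, h2, Units.smul_def, zsmul_eq_mul]
  change ((Nat.factorial 2 * Nat.factorial 2 : ℕ) : ℝ)⁻¹ • (∑ σ : Equiv.Perm (Fin 4), Equiv.Perm.sign σ •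
      (a (fun i : Fin 2 ↦ v (σ (Fin.castAdd 2 i))) * b (fun j : Fin 2 ↦ v (σ (Fin.natAdd 2 j))))) = _
  rw [hsum, Literature.Geometry.Riemannian.altSumFour, smul_eq_mul]
  -- normalise the descending argument pairs
  have ha10 := alt_two_swap_args a (v 0) (v 1)
  have ha20 := alt_two_swap_args a (v 0) (v 2)
  have ha30 := alt_two_swap_args a (v 0) (v 3)
  have ha21 := alt_two_swap_args a (v 1) (v 2)
  have ha31 := alt_two_swap_args a (v 1) (v 3)
  have ha32 := alt_two_swap_args a (v 2) (v 3)
  have hb10 := alt_two_swap_args b (v 0) (v 1)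
  have hb20 := alt_two_swap_args b (v 0) (v 2)
  have hb30 := alt_two_swap_args b (v 0) (v 3)
  have hb21 := alt_two_swap_args b (v 1) (v 2)
  have hb31 := alt_two_swap_args b (v 1) (v 3)
  have hb32 := alt_two_swap_args b (v 2) (v 3)
  rw [ha10, ha20, ha30, ha21, ha31, ha32, hb10, hb20, hb30, hb21, hb31, hb32]
  norm_num [Nat.factorial]
  ring

/-- **`(a ∧ a)(v) = 2 (a(v₀,v₁) a(v₂,v₃) − a(v₀,v₂) a(v₁,v₃) + a(v₀,v₃) a(v₁,v₂))`** for a `2`-form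
`a` — the Pfaffian of `a` on the frame `v` (McDuff–Salamon (2017), proof of Cor. 2.1.4).
[cite: McDuffSalamon2017, §2.1 Cor. 2.1.4] -/
theorem wedge_self_apply_two_two (a : V [⋀^Fin 2]→L[ℝ] ℝ) (v : Fin 4 → V) :
    a.wedge a v =
      2 * (a ![v 0, v 1] * a ![v 2, v 3] - a ![v 0, v 2] * a ![v 1, v 3] + a ![v 0, v 3] * a ![v 1, v 2]) := by
  rw [wedge_apply_two_two]
  ring

/-- **`(α ∧ α)(e₀, e₁, e₂, e₃) = 2 Pf(α)`** for a `2`-form on `ℝ⁴` and the standard basis (the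
tree's `pfaffian`, `OrigamiForm.lean`): "`α ∧ α = 2 Pf(α) e⁰∧e¹∧e²∧e³`".
[cite: McDuffSalamon2017, §2.1 Cor. 2.1.4] -/
theorem wedge_self_apply_stdVec (α : (EuclideanSpace ℝ (Fin 4)) [⋀^Fin 2]→L[ℝ] ℝ) :
    α.wedge α ![stdVec 0, stdVec 1, stdVec 2, stdVec 3] = 2 * pfaffian α := by
  rw [wedge_self_apply_two_two]
  rfl

/-- **A nondegenerate `2`-form on `ℝ⁴` has `α ∧ α ≠ 0`** (McDuff–Salamon (2017), Cor. 2.1.4: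
"`ω` is nondegenerate if and only if `ωⁿ ≠ 0`", here `n = 2`; via `Pf(α) ≠ 0`,
`pfaffian_ne_zero_of_nondegenerate`). [cite: McDuffSalamon2017, §2.1 Cor. 2.1.4] -/
theorem wedge_self_ne_zero_of_nondegenerate (α : (EuclideanSpace ℝ (Fin 4)) [⋀^Fin 2]→L[ℝ] ℝ)
    (hα : ∀ v : EuclideanSpace ℝ (Fin 4), v ≠ 0 → ∃ w, α ![v, w] ≠ 0) : α.wedge α ≠ 0 := by
  intro h0
  have h1 := wedge_self_apply_stdVec α
  rw [h0] at h1
  change (0 : ℝ) = 2 * pfaffian α at h1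
  exact pfaffian_ne_zero_of_nondegenerate α hα (by linarith)

end Algebra

/-! ### The square of a symplectic form on a `4`-manifold -/

section Manifold

variable {N : Type*} [TopologicalSpace N] [ChartedSpace (EuclideanSpace ℝ (Fin 4)) N]

/-- **`(s ∧ s)_x ≠ 0` for a pointwise nondegenerate `2`-form `s` on a `4`-manifold**, in the
degree-`4` copy `(s ∧ s).castDeg (2 + 2 = 4)` (McDuff–Salamon (2017), Cor. 2.1.4 / Def. 4.1.4:
`ω ∧ ω` is a volume form). [cite: McDuffSalamon2017, §2.1 Cor. 2.1.4] -/
theorem wedge_self_castDeg_apply_ne_zero (s : MForm (𝓡 4) N ℝ 2)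
    (hnd : ∀ x (v : TangentSpace (𝓡 4) x), v ≠ 0 → ∃ w : TangentSpace (𝓡 4) x, s x ![v, w] ≠ 0)
    (x : N) : (s.wedge s).castDeg two_add_two_eq_four x ≠ 0 := by
  intro h0
  have hw : (s.wedge s) x = 0 := by
    ext w
    have h1 := congrArg (fun φ : TangentSpace (𝓡 4) x [⋀^Fin 4]→L[ℝ] ℝ ↦
      φ (fun j ↦ w (Fin.cast two_add_two_eq_four.symm j))) h0
    simp only [MForm.castDeg_apply, Fin.cast_eq_self,
      ContinuousAlternatingMap.coe_zero, Pi.zero_apply] at h1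
    exact h1
  rw [MForm.wedge_apply] at hw
  exact wedge_self_ne_zero_of_nondegenerate _ (hnd x) hw

/-- The wedge calculus on a `4`-manifold is unconditional (`wedgeFacts_of_comm` with
`WedgeComm_holds`). [folklore] -/
theorem wedgeFacts_four : WedgeFacts (𝓡 4) N ℝ :=
  wedgeFacts_of_comm (ContinuousAlternatingMap.WedgeComm_holds ℝ (EuclideanSpace ℝ (Fin 4)) ℝ)

/-- **`s ∧ s` is a smooth closed `4`-form** for a smooth closed `2`-form `s` (Leibniz rule,
Warner (1983), 2.20; the tree's `wedge_mem_closedSmoothForms`), in degree `4`.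
[cite: WarnerGTM94, Thm. 2.20] -/
theorem wedge_self_castDeg_mem_closedSmoothForms {s : MForm (𝓡 4) N ℝ 2}
    (hs : s ∈ closedSmoothForms (𝓡 4) N ℝ 2) :
    (s.wedge s).castDeg two_add_two_eq_four ∈ closedSmoothForms (𝓡 4) N ℝ 4 :=
  haveI := wedgeFacts_four (N := N)
  castDeg_mem_closedSmoothForms two_add_two_eq_four (wedge_mem_closedSmoothForms hs hs)

/-- **`[s] ⌣ [s] = [s ∧ s]`** in `H⁴_dR(N)` for a smooth closed `2`-form (the de Rham cup product is
the wedge of representatives, `deRhamCohomology.cup_mk_mk`; Bott–Tu (1982), §I.1).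
[cite: BottTu1982Forms, §I.1] -/
theorem cup_self_deRham_eq {s : MForm (𝓡 4) N ℝ 2} (hs : s ∈ closedSmoothForms (𝓡 4) N ℝ 2) :
    haveI := wedgeFacts_four (N := N)
    deRhamCohomology.cup two_add_two_eq_four (deRhamCohomology.mk ⟨s, hs⟩) (deRhamCohomology.mk ⟨s, hs⟩) =
      deRhamCohomology.mk ⟨(s.wedge s).castDeg two_add_two_eq_four,
        wedge_self_castDeg_mem_closedSmoothForms hs⟩ :=
  rfl

/-- **`⟨e_N [s ∧ s], [N] ⊗ 1⟩ ≠ 0`**: for a smooth closed pointwise-nondegenerate `2`-form `s` on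
a closed connected `4`-manifold `N` and ANY homological `ℤ`-orientation `μ` of `N`, the de Rham
class of the volume form `s ∧ s` pairs non-trivially with `[N] ⊗ 1` under the integration
isomorphism `e_N : H⁴_dR(N) ≃ H⁴(N; ℝ)` (it is nowhere zero, hence not exact:
`kroneckerPairing_integrationDeRham_fundamentalClass_ne_zero`). McDuff–Salamon (2017), proof of
Thm. 13.3.11 (`∫_M ω ∧ ω > 0`). [cite: McDuffSalamon2017, proof of Thm. 13.3.11] -/
theorem kroneckerPairing_integrationDeRham_wedge_self_ne_zero {N : Type} [TopologicalSpace N]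
    [T2Space N] [CompactSpace N] [ConnectedSpace N] [ChartedSpace (EuclideanSpace ℝ (Fin 4)) N]
    [IsManifold (𝓡 4) ∞ N] (μ : HomologicalOrientation ℤ N 4) {s : MForm (𝓡 4) N ℝ 2}
    (hs : s ∈ closedSmoothForms (𝓡 4) N ℝ 2)
    (hnd : ∀ x (v : TangentSpace (𝓡 4) x), v ≠ 0 → ∃ w : TangentSpace (𝓡 4) x, s x ![v, w] ≠ 0) :
    kroneckerPairing ℝ ℝ N 4
        (integrationDeRhamIsoFamily (EuclideanSpace ℝ (Fin 4)) N 4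
          (deRhamCohomology.mk ⟨(s.wedge s).castDeg two_add_two_eq_four,
            wedge_self_castDeg_mem_closedSmoothForms hs⟩))
        (singularHomology.coeffChange N (algebraMap ℤ ℝ : ℤ →+* ℝ).toAddMonoidHom 4
          μ.fundamentalClass) ≠ 0 :=
  kroneckerPairing_integrationDeRham_fundamentalClass_ne_zero μ
    (wedge_self_castDeg_mem_closedSmoothForms hs) (wedge_self_castDeg_apply_ne_zero s hnd)

/-- **`⟨y ∪ y, [N] ⊗ 1⟩ ≠ 0` for the real class `y = e_N [s]` of a symplectic form, granted
multiplicativity of the integration isomorphisms** (`hm`, the residual content of the named fact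
`exists_deRhamIsoFamily`, cf. `exists_deRhamIsoFamily_of_isMultiplicative`): then
`e_N [s] ⌣ e_N [s] = e_N ([s] ⌣ [s]) = e_N [s ∧ s]`, which pairs non-trivially with `[N] ⊗ 1`
(`kroneckerPairing_integrationDeRham_wedge_self_ne_zero`). This is "`[ω] ∪ [ω] ≠ 0`", the input
of `b⁺ ≥ 1` for closed symplectic `4`-manifolds (McDuff–Salamon (2017), proof of Thm. 13.3.11),
for every `ℤ`-orientation `μ`. [cite: McDuffSalamon2017, proof of Thm. 13.3.11] -/
theorem kroneckerPairing_cupProduct_integrationDeRham_ne_zero_of_isMultiplicative {N : Type}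
    [TopologicalSpace N] [T2Space N] [CompactSpace N] [ConnectedSpace N]
    [ChartedSpace (EuclideanSpace ℝ (Fin 4)) N] [IsManifold (𝓡 4) ∞ N]
    (hm : (integrationDeRhamIsoFamily (EuclideanSpace ℝ (Fin 4))).IsMultiplicative)
    (μ : HomologicalOrientation ℤ N 4) {s : MForm (𝓡 4) N ℝ 2}
    (hs : s ∈ closedSmoothForms (𝓡 4) N ℝ 2)
    (hnd : ∀ x (v : TangentSpace (𝓡 4) x), v ≠ 0 → ∃ w : TangentSpace (𝓡 4) x, s x ![v, w] ≠ 0) :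
    kroneckerPairing ℝ ℝ N 4
        (cupProduct two_add_two_eq_four
          (integrationDeRhamIsoFamily (EuclideanSpace ℝ (Fin 4)) N 2 (deRhamCohomology.mk ⟨s, hs⟩))
          (integrationDeRhamIsoFamily (EuclideanSpace ℝ (Fin 4)) N 2 (deRhamCohomology.mk ⟨s, hs⟩)))
        (singularHomology.coeffChange N (algebraMap ℤ ℝ : ℤ →+* ℝ).toAddMonoidHom 4
          μ.fundamentalClass) ≠ 0 := by
  haveI := wedgeFacts_four (N := N)
  have h := hm N 2 2 4 two_add_two_eq_four (deRhamCohomology.mk ⟨s, hs⟩) (deRhamCohomology.mk ⟨s, hs⟩)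
  rw [← h, cup_self_deRham_eq hs]
  exact kroneckerPairing_integrationDeRham_wedge_self_ne_zero μ hs hnd

end Manifold

end Literature.Geometry.Symplectic
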